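import Mathlib
import HarnessLib
import Summits.ValiantsHypothesis.ValiantsHypothesis.Theorems.LacunarySymmetroidMatrixDescartesProductPlusOneBackgroundCell
import Summits.ValiantsHypothesis.ValiantsHypothesis.Theorems.LacunarySymmetroidMatrixDescartesProductPlusOneCrossingInterlace

/-!
# ValiantsHypothesis / LacunarySymmetroid — crux `MatrixDescartes` (stmt-ValiantsHypothesis-18050, V1),
# LINE (A) «product_plus_one», W-cells: the PURE BACKGROUND CELL in FLOOR currency (brick W2-E)

Companion of ✓ `…BackgroundCell` (brick W2: on a window of background rows the company log-Wronskian `W(∏ f_j)` has NO root) in the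
currency of the floor `OneChangeFloorK3` — the Euler numerator `R_{l₀} = Σ_j θ_{l₀}(f_j)·∏_{i≠j} f_i`, `θ_{l₀} f = Σ_l (d_l − d_{l₀}) a_l X^{d_l}`
(the LINE's `eulerNumerator d a l₀`, spelled unfolded as in ✓ `eulerNumerator_roots_Icc_le_wronskian_roots_add_one` and p5's #20c):

* `backgroundRow_eval_ne_zero_Icc`, `background_prod_eval_ne_zero_Icc` — a background row (pen val-idea-25's three-way menu: one-change binomial
  with `0 < f(u)·f(v)`, unswitched incoherent with `0 < f(v)`, coherent with `f(u) < 0`) does not vanish on the CLOSED window `[u, v]`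
  (`0 < u`), hence neither does the product (✓ `row_three_ne_zero_of_binomial` / `row_three_pos_of_le` / `row_three_neg_of_ge`);
* ★ `backgroundCell_eulerNumerator_roots_Icc_le_one` — for EVERY coupling `l₀`, `R_{l₀}` has AT MOST ONE root in the closed window
  `[u, v]`: ✓ `eulerNumerator_roots_Icc_le_wronskian_roots_add_one` (the interlacing frame: `#Z_{[u,v]}(R) ≤ #Z_{(u,v)}(W) + 1` on a pole-free
  window) and ✓ `background_logWronskian_roots_eq_zero` (`#Z_{(u,v)}(W) = 0`);
* `backgroundCell_eulerNumerator_roots_le_one` — the open-window form `(u, v)` (a sub-count), and the gap-letter form `…_gaps`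
  (`d 1 = d 0 + e₁ + 1`, `d 2 = d 1 + e₂ + 1`).

HONEST FRAMING: the `K_trop = 0` cell in floor currency (≤ 1 Euler root per window of pure background); closes NO stub; `OneChangeFloorK3` /
`WronskianBudgetK3` / `stub_classRowK3` / `stub_polyLaw` / `MatrixDescartes` (18050) OPEN; Conjecture B untouched; `VP ≠ VNP` is NOT proved.
No definitions, no named facts. [folklore]
-/

set_option linter.dupNamespace false

namespace Summit.ValiantsHypothesis.ValiantsHypothesis.Theorems.LacunarySymmetroidMatrixDescartes

namespace ProductPlusOne

open Polynomial Finset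
open scoped BigOperators

/-- **A background row does not vanish on the closed window** `[u, v]`, `0 < u`. [this file's lemma] -/
theorem backgroundRow_eval_ne_zero_Icc {d : Fin 3 → ℕ} (hd01 : d 0 < d 1) (hd12 : d 1 < d 2) {a : Fin 3 → ℝ} {u v : ℝ}
    (hu : 0 < u)
    (hrow : ((((a 2 = 0 ∧ a 0 * a 1 < 0) ∨ (a 0 = 0 ∧ a 1 * a 2 < 0) ∨ (a 1 = 0 ∧ a 0 * a 2 < 0)) ∧
          0 < (∑ l, C (a l) * X ^ (d l) : ℝ[X]).eval u * (∑ l, C (a l) * X ^ (d l) : ℝ[X]).eval v) ∨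
        (0 < a 0 ∧ a 1 ≤ 0 ∧ a 2 ≤ 0 ∧ a 1 + a 2 < 0 ∧ 0 < (∑ l, C (a l) * X ^ (d l) : ℝ[X]).eval v) ∨
        (0 < a 0 ∧ 0 < a 1 ∧ a 2 < 0 ∧ (∑ l, C (a l) * X ^ (d l) : ℝ[X]).eval u < 0)))
    {x : ℝ} (hux : u ≤ x) (hxv : x ≤ v) : (∑ l, C (a l) * X ^ (d l) : ℝ[X]).eval x ≠ 0 := by
  have hx : 0 < x := lt_of_lt_of_le hu hux
  rcases hrow with ⟨hb, huv⟩ | ⟨_, h1, h2, _, hv⟩ | ⟨h0, h1, _, hfu⟩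
  · refine row_three_ne_zero_of_binomial hd01 hd12 ?_ hu hux hxv huv
    rcases hb with ⟨h, -⟩ | ⟨h, -⟩ | ⟨h, -⟩
    exacts [Or.inl h, Or.inr (Or.inl h), Or.inr (Or.inr h)]
  · exact (row_three_pos_of_le hd01 hd12 h1 h2 hx hxv hv).ne'
  · exact (row_three_neg_of_ge hd01 hd12 h0 h1 hu hux hfu).ne

/-- **The product of background rows is pole-free on the closed window.** [this file's lemma] -/
theorem background_prod_eval_ne_zero_Icc {m : ℕ} (d : Fin 3 → ℕ) (hd01 : d 0 < d 1) (hd12 : d 1 < d 2)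
    (a : Fin m → Fin 3 → ℝ) {u v : ℝ} (hu : 0 < u)
    (hrow : ∀ j, ((((a j 2 = 0 ∧ a j 0 * a j 1 < 0) ∨ (a j 0 = 0 ∧ a j 1 * a j 2 < 0) ∨ (a j 1 = 0 ∧ a j 0 * a j 2 < 0)) ∧
          0 < (∑ l, C (a j l) * X ^ (d l) : ℝ[X]).eval u * (∑ l, C (a j l) * X ^ (d l) : ℝ[X]).eval v) ∨
        (0 < a j 0 ∧ a j 1 ≤ 0 ∧ a j 2 ≤ 0 ∧ a j 1 + a j 2 < 0 ∧ 0 < (∑ l, C (a j l) * X ^ (d l) : ℝ[X]).eval v) ∨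
        (0 < a j 0 ∧ 0 < a j 1 ∧ a j 2 < 0 ∧ (∑ l, C (a j l) * X ^ (d l) : ℝ[X]).eval u < 0))) :
    ∀ t ∈ Set.Icc u v, (∏ j, ∑ l, C (a j l) * X ^ (d l) : ℝ[X]).eval t ≠ 0 := by
  intro t ht
  rw [eval_prod]
  exact Finset.prod_ne_zero_iff.2 fun j _ => backgroundRow_eval_ne_zero_Icc hd01 hd12 hu (hrow j) ht.1 ht.2

/-- ★ **THE PURE BACKGROUND CELL IN FLOOR CURRENCY:** `K = 3`, `d 0 < d 1 < d 2`, `0 < u`, every row a background row ⇒ for EVERY coupling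
`l₀` the Euler numerator `R_{l₀} = Σ_j θ_{l₀}(f_j)·∏_{i≠j} f_i` has AT MOST ONE root in the CLOSED window `[u, v]`
(interlacing ✓ `eulerNumerator_roots_Icc_le_wronskian_roots_add_one` + ✓ `background_logWronskian_roots_eq_zero`). [this file's theorem] -/
theorem backgroundCell_eulerNumerator_roots_Icc_le_one {m : ℕ} (d : Fin 3 → ℕ) (hd01 : d 0 < d 1) (hd12 : d 1 < d 2)
    (a : Fin m → Fin 3 → ℝ) (l₀ : Fin 3) {u v : ℝ} (hu : 0 < u)
    (hrow : ∀ j, ((((a j 2 = 0 ∧ a j 0 * a j 1 < 0) ∨ (a j 0 = 0 ∧ a j 1 * a j 2 < 0) ∨ (a j 1 = 0 ∧ a j 0 * a j 2 < 0)) ∧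
          0 < (∑ l, C (a j l) * X ^ (d l) : ℝ[X]).eval u * (∑ l, C (a j l) * X ^ (d l) : ℝ[X]).eval v) ∨
        (0 < a j 0 ∧ a j 1 ≤ 0 ∧ a j 2 ≤ 0 ∧ a j 1 + a j 2 < 0 ∧ 0 < (∑ l, C (a j l) * X ^ (d l) : ℝ[X]).eval v) ∨
        (0 < a j 0 ∧ 0 < a j 1 ∧ a j 2 < 0 ∧ (∑ l, C (a j l) * X ^ (d l) : ℝ[X]).eval u < 0))) :
    ((∑ j, (∑ l, C (a j l * ((d l : ℝ) - d l₀)) * X ^ (d l)) * ∏ i ∈ Finset.univ.erase j, (∑ l, C (a i l) * X ^ (d l))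
        : ℝ[X]).roots.toFinset.filter (fun t => u ≤ t ∧ t ≤ v)).card ≤ 1 := by
  have h := eulerNumerator_roots_Icc_le_wronskian_roots_add_one d a l₀ hu
    (background_prod_eval_ne_zero_Icc d hd01 hd12 a hu hrow)
  rw [background_logWronskian_roots_eq_zero d hd01 hd12 a hu hrow, zero_add] at h
  exact h

/-- **Open-window form:** at most one root of `R_{l₀}` in `(u, v)`. [this file's theorem] -/
theorem backgroundCell_eulerNumerator_roots_le_one {m : ℕ} (d : Fin 3 → ℕ) (hd01 : d 0 < d 1) (hd12 : d 1 < d 2)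
    (a : Fin m → Fin 3 → ℝ) (l₀ : Fin 3) {u v : ℝ} (hu : 0 < u)
    (hrow : ∀ j, ((((a j 2 = 0 ∧ a j 0 * a j 1 < 0) ∨ (a j 0 = 0 ∧ a j 1 * a j 2 < 0) ∨ (a j 1 = 0 ∧ a j 0 * a j 2 < 0)) ∧
          0 < (∑ l, C (a j l) * X ^ (d l) : ℝ[X]).eval u * (∑ l, C (a j l) * X ^ (d l) : ℝ[X]).eval v) ∨
        (0 < a j 0 ∧ a j 1 ≤ 0 ∧ a j 2 ≤ 0 ∧ a j 1 + a j 2 < 0 ∧ 0 < (∑ l, C (a j l) * X ^ (d l) : ℝ[X]).eval v) ∨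
        (0 < a j 0 ∧ 0 < a j 1 ∧ a j 2 < 0 ∧ (∑ l, C (a j l) * X ^ (d l) : ℝ[X]).eval u < 0))) :
    ((∑ j, (∑ l, C (a j l * ((d l : ℝ) - d l₀)) * X ^ (d l)) * ∏ i ∈ Finset.univ.erase j, (∑ l, C (a i l) * X ^ (d l))
        : ℝ[X]).roots.toFinset.filter (fun t => u < t ∧ t < v)).card ≤ 1 := by
  refine le_trans (Finset.card_le_card (Finset.monotone_filter_right _ fun t _ ht => ?_))
    (backgroundCell_eulerNumerator_roots_Icc_le_one d hd01 hd12 a l₀ hu hrow)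
  exact ⟨ht.1.le, ht.2.le⟩

/-- **Gap-letter form** (`d 1 = d 0 + e₁ + 1`, `d 2 = d 1 + e₂ + 1`, the LINE's wiring): at most one root of `R_{l₀}` in `(u, v)`.
[this file's theorem] -/
theorem backgroundCell_eulerNumerator_roots_le_one_gaps {m : ℕ} (d : Fin 3 → ℕ) (e₁ e₂ : ℕ) (he₁ : d 1 = d 0 + e₁ + 1)
    (he₂ : d 2 = d 1 + e₂ + 1) (a : Fin m → Fin 3 → ℝ) (l₀ : Fin 3) {u v : ℝ} (hu : 0 < u)
    (hrow : ∀ j, ((((a j 2 = 0 ∧ a j 0 * a j 1 < 0) ∨ (a j 0 = 0 ∧ a j 1 * a j 2 < 0) ∨ (a j 1 = 0 ∧ a j 0 * a j 2 < 0)) ∧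
          0 < (∑ l, C (a j l) * X ^ (d l) : ℝ[X]).eval u * (∑ l, C (a j l) * X ^ (d l) : ℝ[X]).eval v) ∨
        (0 < a j 0 ∧ a j 1 ≤ 0 ∧ a j 2 ≤ 0 ∧ a j 1 + a j 2 < 0 ∧ 0 < (∑ l, C (a j l) * X ^ (d l) : ℝ[X]).eval v) ∨
        (0 < a j 0 ∧ 0 < a j 1 ∧ a j 2 < 0 ∧ (∑ l, C (a j l) * X ^ (d l) : ℝ[X]).eval u < 0))) :
    ((∑ j, (∑ l, C (a j l * ((d l : ℝ) - d l₀)) * X ^ (d l)) * ∏ i ∈ Finset.univ.erase j, (∑ l, C (a i l) * X ^ (d l))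
        : ℝ[X]).roots.toFinset.filter (fun t => u < t ∧ t < v)).card ≤ 1 :=
  backgroundCell_eulerNumerator_roots_le_one d (by omega) (by omega) a l₀ hu hrow

end ProductPlusOne

end Summit.ValiantsHypothesis.ValiantsHypothesis.Theorems.LacunarySymmetroidMatrixDescartes
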